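/-
Copyright: seat `ym-line-cbag-p2` (prover-ym-line-cbag-p2-g0-0), route `ColdBoxAllGroups`, crux `BulkAllGroups`
(stmt-QuantumFields-22255), line `dlr-chessboard-G` (skeleton `Cruxes/BulkAllGroups/Lines/birth.lean`).
-/
import Summits.QuantumFields.YangMills.Theorems.ColdBoxAllGroupsBulkAllGroupsCrudeGoodGaugeG
import Summits.QuantumFields.YangMills.Theorems.WeakCouplingRatesBulkDominatesColdBoxWSmallLinksDatum

/-!
# Crux `BulkAllGroups` (stmt-QuantumFields-22255), interfaces `KernelMeanExpansionG` / `KernelCovExpansionG`: SMALL LINKS in the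
# temporal-forest gauge with a small exterior datum, ANY compact gauge group — G-port of `…BulkDominatesColdBoxWSmallLinksDatum` §1

`opDist1_le_uniform_of_exterior_leG` — the instantiation of the G-free M2 `ell_le_uniform_of_exterior_le` (module
`…BulkDominatesColdBoxWForestPoincareDatum`) with the length `ℓ = opDist1 ∘ ρ = ‖ρ(·) − 1‖_op` of a unitary representation `ρ` of degree
`N ≥ 1` (`ℓ 1 = 0`, subadditive, inversion and conjugation invariant — tree `UnitaryModel.opDist1_map_mul_le / _map_inv / _map_conj`): if the
exterior links of `V : ℤ⁴ → G` are within `r` of `1`, the forest links are `1`, and every plaquette has cost `N − Re tr ρ ≤ c`, then EVERY link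
satisfies `‖ρ(V_e) − 1‖_op ≤ (12H²+2H+1)(√(2c) + 4r)` (`H ≥ 1`) — the sup-norm smallness feeding the cubic chart remainder on the good event,
uniformly over crude-good data (`r` from `exists_gauge_opDist1_le_of_crudeGoodG`, `c = β^{2ε−1}` from `boxKernelG_largeField_rarity_crudeGood`).
(The companion `dirBackground_sq_le_formM` of the `SU(2)` file is G-free and is reused by import.)  No new definition; standard axioms.
NOT a claim about the mass gap; the Yang–Mills mass gap is NOT proved by any of this.
-/

set_option autoImplicit false

noncomputable section

open Finset
open scoped Matrix.Norms.L2Operator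
open Literature.Probability.LatticeModels Literature.MathematicalPhysics Literature.MathematicalPhysics.QuantumLattice
open Literature.MathematicalPhysics.QuantumFieldTheory Literature.MathematicalPhysics.QuantumFieldTheory.AxialGauge
open Literature.MathematicalPhysics.QuantumFieldTheory.LatticeMaxwell
open Literature.MathematicalPhysics.QuantumFieldTheory.Balaban1983to89 Literature.MathematicalPhysics.QuantumFieldTheory.Balaban1983to89.UnitaryModel
open Summit.QuantumFields.YangMills.Theorems.WeakCouplingRates

namespace Summit.QuantumFields.YangMills.Theorems.ColdBoxAllGroups

variable {N : ℕ} [NeZero N] {G : Type*} [Group G]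
variable (ρ : G →* Matrix (Fin N) (Fin N) ℂ) (hρu : ∀ g, ρ g ∈ Matrix.unitaryGroup (Fin N) ℂ)
include hρu

/-- **Small links in the forest gauge with a small exterior, any compact `G`.**  Let `V : ℤ⁴ → G` have exterior links (off the cold box
`boxEdges 4 (2H+1)`) within `r ≥ 0` of `1` in operator norm along the unitary `ρ` (degree `N ≥ 1`), forest links equal to `1`, and all plaquette
costs `N − Re tr ρ(V_p) ≤ c`.  Then every link satisfies `‖ρ(V_e) − 1‖_op ≤ (12H² + 2H + 1)·(√(2c) + 4r)` (`H ≥ 1`). [folklore] -/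
theorem opDist1_le_uniform_of_exterior_leG {H : ℕ} (hH : 1 ≤ H) (V : LGConfig 4 G) {r c : ℝ}
    (hr : 0 ≤ r) (hout : ∀ e, e ∉ boxEdges 4 (2 * H + 1) → opDist1 (ρ (V e)) ≤ r)
    (hforest : ∀ x : Site 4, (∀ k : Fin 4, 1 ≤ x k ∧ x k + 1 ≤ 2 * (H : ℤ)) → V (x, 0) = 1)
    (hc : ∀ (x : Site 4) (i j : Fin 4), (N : ℝ) - (ρ (plaquetteHolonomyZd V x i j)).trace.re ≤ c)
    (e : Literature.MathematicalPhysics.QuantumLattice.ZdEdge 4) :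
    opDist1 (ρ (V e)) ≤ (12 * (H : ℝ) ^ 2 + 2 * H + 1) * (Real.sqrt (2 * c) + 4 * r) := by
  have hM : ∀ (x : Site 4) (i j : Fin 4), opDist1 (ρ (plaquetteHolonomyZd V x i j)) ≤ Real.sqrt (2 * c) :=
    fun x i j => opDist1_le_sqrt_of_cost_leG ρ hρu (hc x i j)
  exact ell_le_uniform_of_exterior_le (fun g => opDist1 (ρ g))
    (by simp only [map_one]; exact UnitaryModel.opDist1_one)
    (fun x y => opDist1_map_mul_le ρ hρu x y)
    (fun x => opDist1_map_inv ρ hρu x)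
    (fun x g => opDist1_map_conj ρ hρu g x)
    V hout hforest hM hH hr e

end Summit.QuantumFields.YangMills.Theorems.ColdBoxAllGroups

end
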